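import Summits.QuantumFields.YangMills.Theorems.LuscherReductionTwistedTraceScalingBOStiffSepConditions
import Summits.QuantumFields.YangMills.Theorems.LuscherReductionTwistedTraceScalingBOCentralSchedule
import Summits.QuantumFields.YangMills.Theorems.LuscherReductionTwistedTraceScalingBOCentralEventually
import Summits.QuantumFields.YangMills.Theorems.LuscherReductionTwistedTraceScalingRecordInequalities
import HarnessLib

/-!
# (C5-α″, schedule) THE SIX NUMERIC CONDITIONS OF RECORD STIFF SEPARATION HOLD EVENTUALLY ON SCHEDULE B, for every `s ∈ (1/6, 1/2)`
# (lane A of S-BASE, crux `TwistedTraceScaling` stmt-QuantumFields-20203, C4-CORE, the (OD) pen; `pub/ym-fleet/ym-luscher-20007-p1/HANDOFF-g20.md` (α″))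

With `r_F = min(1/40, β^{-1/2}ℓ)`, `τ = β^{-1}ℓ`, `δ = recordDelta1 = 14β^{-s}/|Site|`, `δ' = 517β^{-s}/|Site|`, `a_U = 43Mβ^{-s}`, atoms `ε₁ = 14β^{-s}`, `ε₂ = 14³β^{-(3s−1/2)}`
(`→ 0` iff `s > 1/6`): eventually `r_F = β^{-1/2}ℓ ≤ ε₁`, `τ = β^{-1/2}·r_F ≤ r_F/10⁴`, `ε₁³ ≤ ε₂r_F`, and the three polynomial conditions of `…BOStiffSepConditions.stiffSep_conditions`
(continuous in `(r_F, ε₁, ε₂)`, vanishing at `0`) — hence ALL hypotheses of `…BOStiffSepRecord.avgKernel_le_of_stiffSep_record`: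
★★ `eventually_stiffSep_conditions`.
HONEST FRAMING: bookkeeping for a stub of a child of the CONDITIONAL route R2b1; the `hsep` wrapper over `S_out × V_in`, the hOD assembly, (B-ST), C4-CORE OPEN; not a gap, not Clay.
-/

set_option autoImplicit false

noncomputable section

open Filter Topology Real
open scoped BigOperators
open Literature.MathematicalPhysics.QuantumFieldTheory
open Literature.MathematicalPhysics.QuantumLattice

namespace Summit.QuantumFields.YangMills.Theorems.FemtoTransferGap.TwoLattice.ConstTube

open Summit.QuantumFields.YangMills.Theorems.FemtoTransferGap
open Summit.QuantumFields.YangMills.Theorems.FemtoTransferGap.TwoLattice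

variable {L : ℕ} [NeZero L]

set_option maxHeartbeats 1600000 in
-- long eventual bookkeeping with the explicit record expressions.
/-- ★★ **THE STIFF-SEPARATION SCHEDULE** (see the module docstring). [folklore] -/
theorem eventually_stiffSep_conditions {s : ℝ} (hs6 : 1 / 6 < s) (hs2 : s < 1 / 2) {M : ℝ} (hM : 0 ≤ M) {C : ℝ} (hC : 0 < C) :
    ∀ᶠ β : ℝ in atTop,
      0 ≤ (min (1 / 40) (powScale (1 / 2) β * btLog β)) ∧ (min (1 / 40) (powScale (1 / 2) β * btLog β)) / 24 ≤ 1 / 20 ∧ 0 ≤ (powScale 1 β * btLog β) ∧ 0 ≤ (recordDelta1 L s β) ∧ (recordDelta1 L s β) ≤ 1 ∧ 0 ≤ (517 / Fintype.card (Site 3 L) * powScale s β) ∧ 0 ≤ (M * (43 * powScale s β)) ∧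
      12 * Real.sqrt (3 * Fintype.card (Edge 3 L)) * (recordDelta1 L s β) * C ≤ 1 / 2 ∧
      3 * L * (((min (1 / 40) (powScale (1 / 2) β * btLog β)) / 1000) + (M * (43 * powScale s β)) + (Real.sqrt 2 * ((min (1 / 40) (powScale (1 / 2) β * btLog β)) / 24) + (recordDelta1 L s β))) ≤ 1 / 40 ∧
      2 * (2 * C * (2 * (powScale 1 β * btLog β) + (Real.sqrt 6 * ((min (1 / 40) (powScale (1 / 2) β * btLog β)) / 1000) + Real.sqrt (6 * Fintype.card (Edge 3 L)) * ((40 * (4 * (3 * L * (((min (1 / 40) (powScale (1 / 2) β * btLog β)) / 1000) + (M * (43 * powScale s β)) + (Real.sqrt 2 * ((min (1 / 40) (powScale (1 / 2) β * btLog β)) / 24) + (recordDelta1 L s β)))) ^ 2 + 2 * (3 * L * (((min (1 / 40) (powScale (1 / 2) β * btLog β)) / 1000) + (M * (43 * powScale s β)) + (Real.sqrt 2 * ((min (1 / 40) (powScale (1 / 2) β * btLog β)) / 24) + (recordDelta1 L s β)))) * ((min (1 / 40) (powScale (1 / 2) β * btLog β)) / 24)) + 12 * (recordDelta1 L s β)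 * (3 * L * (((min (1 / 40) (powScale (1 / 2) β * btLog β)) / 1000) + (M * (43 * powScale s β)) + (Real.sqrt 2 * ((min (1 / 40) (powScale (1 / 2) β * btLog β)) / 24) + (recordDelta1 L s β))))) + 4 * (6 * (3 * L * (((min (1 / 40) (powScale (1 / 2) β * btLog β)) / 1000) + (M * (43 * powScale s β)) + (Real.sqrt 2 * ((min (1 / 40) (powScale (1 / 2) β * btLog β)) / 24) + (recordDelta1 L s β)))) + 2 * ((min (1 / 40) (powScale (1 / 2) β * btLog β)) / 24)) * ((recordDelta1 L s β) + (517 / Fintype.card (Site 3 L) * powScale s β)))))) ≤ 1 / 40 ∧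
      (powScale 1 β * btLog β) ^ 2 + (((min (1 / 40) (powScale (1 / 2) β * btLog β)) / 24) + 4 * (powScale 1 β * btLog β) + 4 * (Real.sqrt 6 * ((min (1 / 40) (powScale (1 / 2) β * btLog β)) / 1000) + Real.sqrt (6 * Fintype.card (Edge 3 L)) *
      ((40 * (4 * (2 * (2 * C * (2 * (powScale 1 β * btLog β) + (Real.sqrt 6 * ((min (1 / 40) (powScale (1 / 2) β * btLog β)) / 1000) + Real.sqrt (6 * Fintype.card (Edge 3 L)) * ((40 * (4 * (3 * L * (((min (1 / 40) (powScale (1 / 2) β * btLog β)) / 1000) + (M * (43 * powScale s β)) + (Real.sqrt 2 * ((min (1 / 40) (powScale (1 / 2) β * btLog β)) / 24) + (recordDelta1 L s β)))) ^ 2 + 2 * (3 * L * (((min (1 / 40) (powScale (1 / 2) β * btLog β)) / 1000) + (M * (43 * powScale s β)) + (Real.sqrt 2 * ((min (1 / 40) (powScale (1 / 2) β * btLog β)) / 24) + (recordDelta1 L s β)))) * ((min (1 / 40) (powScale (1 / 2) β * btLog β)) / 24)) + 12 * (recordDelta1 L s β) * (3 * L * (((min (1 / 40) (powScale (1 / 2)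 β * btLog β)) / 1000) + (M * (43 * powScale s β)) + (Real.sqrt 2 * ((min (1 / 40) (powScale (1 / 2) β * btLog β)) / 24) + (recordDelta1 L s β))))) + 4 * (6 * (3 * L * (((min (1 / 40) (powScale (1 / 2) β * btLog β)) / 1000) + (M * (43 * powScale s β)) + (Real.sqrt 2 * ((min (1 / 40) (powScale (1 / 2) β * btLog β)) / 24) + (recordDelta1 L s β)))) + 2 * ((min (1 / 40) (powScale (1 / 2) β * btLog β)) / 24)) * ((recordDelta1 L s β) + (517 / Fintype.card (Site 3 L) * powScale s β))))))) ^ 2 +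
          2 * (2 * (2 * C * (2 * (powScale 1 β * btLog β) + (Real.sqrt 6 * ((min (1 / 40) (powScale (1 / 2) β * btLog β)) / 1000) + Real.sqrt (6 * Fintype.card (Edge 3 L)) * ((40 * (4 * (3 * L * (((min (1 / 40) (powScale (1 / 2) β * btLog β)) / 1000) + (M * (43 * powScale s β)) + (Real.sqrt 2 * ((min (1 / 40) (powScale (1 / 2) β * btLog β)) / 24) + (recordDelta1 L s β)))) ^ 2 + 2 * (3 * L * (((min (1 / 40) (powScale (1 / 2) β * btLog β)) / 1000) + (M * (43 * powScale s β)) + (Real.sqrt 2 * ((min (1 / 40) (powScale (1 / 2) β * btLog β)) / 24) + (recordDelta1 L s β)))) * ((min (1 / 40) (powScale (1 / 2) β * btLog β)) / 24)) + 12 * (recordDelta1 L s β) * (3 * L * (((min (1 / 40) (powScale (1 / 2) β * btLog β)) / 1000) + (M * (43 * powScale s β)) + (Real.sqrt 2 * ((min (1 / 40) (powScale (1 / 2) β * btLog β)) / 24) + (recordDelta1 L s β))))) + 4 * (6 * (3 * L * (((min (1 / 40) (powScale (1 / 2) β * btLog β)) / 1000) + (M * (43 * powScale s β)) + (Real.sqrt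 2 * ((min (1 / 40) (powScale (1 / 2) β * btLog β)) / 24) + (recordDelta1 L s β)))) + 2 * ((min (1 / 40) (powScale (1 / 2) β * btLog β)) / 24)) * ((recordDelta1 L s β) + (517 / Fintype.card (Site 3 L) * powScale s β))))))) * ((min (1 / 40) (powScale (1 / 2) β * btLog β)) / 24)) +
        12 * (recordDelta1 L s β) * (2 * C * (2 * (powScale 1 β * btLog β) + (Real.sqrt 6 * ((min (1 / 40) (powScale (1 / 2) β * btLog β)) / 1000) + Real.sqrt (6 * Fintype.card (Edge 3 L)) * ((40 * (4 * (3 * L * (((min (1 / 40) (powScale (1 / 2) β * btLog β)) / 1000) + (M * (43 * powScale s β)) + (Real.sqrt 2 * ((min (1 / 40) (powScale (1 / 2) β * btLog β)) / 24) + (recordDelta1 L s β)))) ^ 2 + 2 * (3 * L * (((min (1 / 40) (powScale (1 / 2) β * btLog β)) / 1000) + (M * (43 * powScale s β)) + (Real.sqrt 2 * ((min (1 / 40) (powScale (1 / 2) β * btLog β)) / 24) + (recordDelta1 L s β)))) * ((min (1 / 40) (powScale (1 / 2) β * btLog β)) / 24)) + 12 * (recordDelta1 L s β) * (3 * L * (((min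 (1 / 40) (powScale (1 / 2) β * btLog β)) / 1000) + (M * (43 * powScale s β)) + (Real.sqrt 2 * ((min (1 / 40) (powScale (1 / 2) β * btLog β)) / 24) + (recordDelta1 L s β))))) + 4 * (6 * (3 * L * (((min (1 / 40) (powScale (1 / 2) β * btLog β)) / 1000) + (M * (43 * powScale s β)) + (Real.sqrt 2 * ((min (1 / 40) (powScale (1 / 2) β * btLog β)) / 24) + (recordDelta1 L s β)))) + 2 * ((min (1 / 40) (powScale (1 / 2) β * btLog β)) / 24)) * ((recordDelta1 L s β) + (517 / Fintype.card (Site 3 L) * powScale s β))))))) +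
        4 * (6 * (2 * (2 * C * (2 * (powScale 1 β * btLog β) + (Real.sqrt 6 * ((min (1 / 40) (powScale (1 / 2) β * btLog β)) / 1000) + Real.sqrt (6 * Fintype.card (Edge 3 L)) * ((40 * (4 * (3 * L * (((min (1 / 40) (powScale (1 / 2) β * btLog β)) / 1000) + (M * (43 * powScale s β)) + (Real.sqrt 2 * ((min (1 / 40) (powScale (1 / 2) β * btLog β)) / 24) + (recordDelta1 L s β)))) ^ 2 + 2 * (3 * L * (((min (1 / 40) (powScale (1 / 2) β * btLog β)) / 1000) + (M * (43 * powScale s β)) + (Real.sqrt 2 * ((min (1 / 40) (powScale (1 / 2) β * btLog β)) / 24) + (recordDelta1 L s β)))) * ((min (1 / 40) (powScale (1 / 2) β * btLog β)) / 24)) + 12 * (recordDelta1 L s β) * (3 * L * (((min (1 / 40) (powScale (1 / 2) β * btLog β)) / 1000) + (M * (43 * powScale s β)) + (Real.sqrt 2 * ((min (1 / 40) (powScale (1 / 2) β * btLog β)) / 24) + (recordDelta1 L s β))))) + 4 * (6 * (3 * L * (((min (1 / 40) (powScale (1 / 2) β * btLog β)) / 1000) + (M * (43 * powScale s β)) + (Real.sqrt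 2 * ((min (1 / 40) (powScale (1 / 2) β * btLog β)) / 24) + (recordDelta1 L s β)))) + 2 * ((min (1 / 40) (powScale (1 / 2) β * btLog β)) / 24)) * ((recordDelta1 L s β) + (517 / Fintype.card (Site 3 L) * powScale s β))))))) + 2 * ((min (1 / 40) (powScale (1 / 2) β * btLog β)) / 24)) * ((recordDelta1 L s β) + (517 / Fintype.card (Site 3 L) * powScale s β))))) ^ 2 ≤ ((min (1 / 40) (powScale (1 / 2) β * btLog β)) / 12) ^ 2 := by
  have hs : 0 < s := by linarith
  have hN1 : (1 : ℝ) ≤ Fintype.card (Site 3 L) := by exact_mod_cast Fintype.card_pos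
  have hN : (0 : ℝ) < Fintype.card (Site 3 L) := by linarith
  -- the atoms
  have hr := tendsto_rf
  have hε₁ : Tendsto (fun β : ℝ => 14 * powScale s β) atTop (𝓝 0) := by simpa using (tendsto_powScale hs).const_mul 14
  have hε₂ : Tendsto (fun β : ℝ => (14 : ℝ) ^ 3 * powScale (3 * s - 1 / 2) β) atTop (𝓝 0) := by
    simpa using (tendsto_powScale (σ := 3 * s - 1 / 2) (by linarith)).const_mul ((14 : ℝ) ^ 3)
  have hatoms : Tendsto (fun β : ℝ => (powScale (1 / 2) β * btLog β, 14 * powScale s β, (14 : ℝ) ^ 3 * powScale (3 * s - 1 / 2) β)) atTop (𝓝 ((0 : ℝ), (0 : ℝ), (0 : ℝ))) :=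
    hr.prodMk_nhds (hε₁.prodMk_nhds hε₂)
  -- the three polynomial conditions by continuity
  have hPθ : ∀ᶠ β : ℝ in atTop, (3 * L * (2 + 43 * M)) * (14 * powScale s β) ≤ 1 / 40 := by
    have h := hε₁.const_mul (3 * L * (2 + 43 * M))
    rw [mul_zero] at h
    exact h.eventually (eventually_le_nhds (by norm_num))
  have hPq : ∀ᶠ β : ℝ in atTop, 2 * C * ((powScale (1 / 2) β * btLog β) / 100 + Real.sqrt (6 * Fintype.card (Edge 3 L)) * (160 * (3 * L * (2 + 43 * M)) ^ 2 + 10 / 3 * (3 * L * (2 + 43 * M)) + 12 * (3 * L * (2 + 43 * M)) + 152 * (6 * (3 * L * (2 + 43 * M)) + 1 / 12)) * (14 * powScale s β) ^ 2) ≤ 1 / 80 := by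
    set P : ℝ × ℝ × ℝ → ℝ := fun p => 2 * C * (p.1 / 100 + Real.sqrt (6 * Fintype.card (Edge 3 L)) * (160 * (3 * L * (2 + 43 * M)) ^ 2 + 10 / 3 * (3 * L * (2 + 43 * M)) + 12 * (3 * L * (2 + 43 * M)) + 152 * (6 * (3 * L * (2 + 43 * M)) + 1 / 12)) * p.2.1 ^ 2) with hP
    have hc : Continuous P := by rw [hP]; fun_prop
    have h := (hc.tendsto ((0 : ℝ), (0 : ℝ), (0 : ℝ))).comp hatoms
    have h0 : P ((0 : ℝ), (0 : ℝ), (0 : ℝ)) = 0 := by rw [hP]; norm_num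
    rw [h0] at h
    filter_upwards [h.eventually (eventually_le_nhds (by norm_num : (0:ℝ) < 1 / 80))] with β hβ
    simpa only [hP, Function.comp] using hβ
  have hPfin : ∀ᶠ β : ℝ in atTop, Real.sqrt (6 * Fintype.card (Edge 3 L)) * (640 * (8 * C ^ 2 * (powScale (1 / 2) β * btLog β) / 10 ^ 4 + 8 * C ^ 2 * Real.sqrt (6 * Fintype.card (Edge 3 L)) ^ 2 * (160 * (3 * L * (2 + 43 * M)) ^ 2 + 10 / 3 * (3 * L * (2 + 43 * M)) + 12 * (3 * L * (2 + 43 * M)) + 152 * (6 * (3 * L * (2 + 43 * M)) + 1 / 12)) ^ 2 * ((14 * powScale s β) * (14 ^ 3 * powScale (3 * s - 1 / 2) β))) + 20 / 3 * (2 * C * (powScale (1 / 2) β * btLog β) / 100 + 2 * C * Real.sqrt (6 * Fintype.card (Edge 3 L)) * (160 * (3 * L * (2 + 43 * M)) ^ 2 + 10 / 3 * (3 * L * (2 + 43 * M)) + 12 * (3 * L * (2 + 43 * M)) + 152 * (6 * (3 * L * (2 + 43 * M)) + 1 / 12)) * (14 * powScale s β) ^ 2) + 1836 * (2 * C * (14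 * powScale s β) / 100 + 2 * C * Real.sqrt (6 * Fintype.card (Edge 3 L)) * (160 * (3 * L * (2 + 43 * M)) ^ 2 + 10 / 3 * (3 * L * (2 + 43 * M)) + 12 * (3 * L * (2 + 43 * M)) + 152 * (6 * (3 * L * (2 + 43 * M)) + 1 / 12)) * (14 ^ 3 * powScale (3 * s - 1 / 2) β)) + 38 / 3 * (14 * powScale s β)) ≤ 1 / 10000 := by
    set P : ℝ × ℝ × ℝ → ℝ := fun p => Real.sqrt (6 * Fintype.card (Edge 3 L)) * (640 * (8 * C ^ 2 * p.1 / 10 ^ 4 + 8 * C ^ 2 * Real.sqrt (6 * Fintype.card (Edge 3 L)) ^ 2 * (160 * (3 * L * (2 + 43 * M)) ^ 2 + 10 / 3 * (3 * L * (2 + 43 * M)) + 12 * (3 * L * (2 + 43 * M)) + 152 * (6 * (3 * L * (2 + 43 * M)) + 1 / 12)) ^ 2 * (p.2.1 * p.2.2)) + 20 / 3 * (2 * C * p.1 / 100 + 2 * C * Real.sqrt (6 * Fintype.card (Edge 3 L)) * (160 * (3 * L * (2 + 43 * M)) ^ 2 + 10 / 3 * (3 * L * (2 + 43 * M)) + 12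 * (3 * L * (2 + 43 * M)) + 152 * (6 * (3 * L * (2 + 43 * M)) + 1 / 12)) * p.2.1 ^ 2) + 1836 * (2 * C * p.2.1 / 100 + 2 * C * Real.sqrt (6 * Fintype.card (Edge 3 L)) * (160 * (3 * L * (2 + 43 * M)) ^ 2 + 10 / 3 * (3 * L * (2 + 43 * M)) + 12 * (3 * L * (2 + 43 * M)) + 152 * (6 * (3 * L * (2 + 43 * M)) + 1 / 12)) * p.2.2) + 38 / 3 * p.2.1) with hP
    have hc : Continuous P := by rw [hP]; fun_prop
    have h := (hc.tendsto ((0 : ℝ), (0 : ℝ), (0 : ℝ))).comp hatoms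
    have h0 : P ((0 : ℝ), (0 : ℝ), (0 : ℝ)) = 0 := by rw [hP]; norm_num
    rw [h0] at h
    filter_upwards [h.eventually (eventually_le_nhds (by norm_num : (0:ℝ) < 1 / 10000))] with β hβ
    simpa only [hP, Function.comp] using hβ
  -- elementary schedule facts
  have e1 : ∀ᶠ β : ℝ in atTop, min (1 / 40) (powScale (1 / 2) β * btLog β) = powScale (1 / 2) β * btLog β := by
    filter_upwards [eventually_mul_le_of_tendsto hr 1 (by norm_num : (0:ℝ) < 1 / 40)] with β h
    rw [one_mul] at h; exact min_eq_right h
  have e2 : ∀ᶠ β : ℝ in atTop, powScale (1 / 2) β ≤ 1 / 10000 := (tendsto_powScale (σ := 1 / 2) (by norm_num)).eventually (eventually_le_nhds (by norm_num))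
  have e3 : ∀ᶠ β : ℝ in atTop, powScale (1 / 2 - s) β * btLog β ≤ 14 := by
    have h := tendsto_powScale_mul_btLog_pow (p := 1 / 2 - s) (by linarith) 1
    simp only [pow_one] at h
    exact h.eventually (eventually_le_nhds (by norm_num))
  have e4 : ∀ᶠ β : ℝ in atTop, recordDelta1 L s β ≤ 1 ∧ 12 * Real.sqrt (3 * Fintype.card (Edge 3 L)) * recordDelta1 L s β * C ≤ 1 / 2 := by
    have hδt : Tendsto (fun β : ℝ => recordDelta1 L s β) atTop (𝓝 0) := by
      have h := (tendsto_powScale hs).const_mul (14 / (Fintype.card (Site 3 L) : ℝ))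
      rw [mul_zero] at h
      refine h.congr fun β => ?_
      unfold recordDelta1; ring
    have h2 := (hδt.const_mul (12 * Real.sqrt (3 * Fintype.card (Edge 3 L)))).mul_const C
    rw [mul_zero, zero_mul] at h2
    filter_upwards [hδt.eventually (eventually_le_nhds one_pos), h2.eventually (eventually_le_nhds (by norm_num : (0:ℝ) < 1 / 2))] with β h1 h3
    exact ⟨h1, by simpa [mul_assoc] using h3⟩
  filter_upwards [hPθ, hPq, hPfin, e1, e2, e3, e4, eventually_ge_atTop (1 : ℝ)] with β hθ hq hfin hrf hx4 hxs ⟨hδ1, hδC⟩ hβ1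
  -- positivity of the data
  have hx0 : 0 < powScale (1 / 2) β := powScale_pos _ _
  have hℓ1 : 1 ≤ btLog β := one_le_btLog β
  have hℓ0 : 0 ≤ btLog β := zero_le_one.trans hℓ1
  have hps0 : 0 < powScale s β := powScale_pos _ _
  have hrF0 : 0 ≤ (min (1 / 40) (powScale (1 / 2) β * btLog β)) := le_min (by norm_num) (mul_nonneg hx0.le hℓ0)
  have hrF40 : (min (1 / 40) (powScale (1 / 2) β * btLog β)) ≤ 1 / 40 := min_le_left _ _
  have hτ0 : 0 ≤ (powScale 1 β * btLog β) := mul_nonneg (powScale_pos _ _).le hℓ0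
  have hδ0 : 0 ≤ (recordDelta1 L s β) := by unfold recordDelta1; positivity
  have hδ'0 : 0 ≤ (517 / Fintype.card (Site 3 L) * powScale s β) := by positivity
  have haU0 : 0 ≤ (M * (43 * powScale s β)) := by positivity
  have hε₁0 : 0 ≤ 14 * powScale s β := by positivity
  -- the atom inequalities
  have hrF : (min (1 / 40) (powScale (1 / 2) β * btLog β)) ≤ 14 * powScale s β := by
    rw [hrf]
    have e : powScale (1 / 2) β * btLog β = (powScale (1 / 2 - s) β * btLog β) * powScale s β := by
      rw [mul_assoc, mul_comm (btLog β), ← mul_assoc, powScale_mul_powScale]; ring_nf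
    rw [e]; exact mul_le_mul_of_nonneg_right hxs hps0.le
  have hδ : (recordDelta1 L s β) ≤ 14 * powScale s β := by
    unfold recordDelta1
    rw [div_le_iff₀ hN]
    nlinarith [hps0]
  have hδ' : (517 / Fintype.card (Site 3 L) * powScale s β) ≤ 37 * (14 * powScale s β) := by
    have h1 : (517 : ℝ) / Fintype.card (Site 3 L) ≤ 517 := div_le_self (by norm_num) hN1
    nlinarith [hps0]
  have haU : (M * (43 * powScale s β)) ≤ 43 * M * (14 * powScale s β) := by nlinarith [hps0, hM]
  have hτ : (powScale 1 β * btLog β) ≤ (min (1 / 40) (powScale (1 / 2) β * btLog β)) / 10000 := by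
    rw [hrf]
    have e : powScale 1 β = powScale (1 / 2) β * powScale (1 / 2) β := by rw [powScale_mul_powScale]; norm_num
    rw [e]
    have := mul_le_mul_of_nonneg_right hx4 (mul_nonneg hx0.le hℓ0)
    nlinarith [this]
  have hε13 : (14 * powScale s β) ^ 3 ≤ ((14 : ℝ) ^ 3 * powScale (3 * s - 1 / 2) β) * (min (1 / 40) (powScale (1 / 2) β * btLog β)) := by
    rw [hrf]
    have e : (14 * powScale s β) ^ 3 = (14 : ℝ) ^ 3 * (powScale (3 * s - 1 / 2) β * powScale (1 / 2) β) := by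
      rw [mul_pow, powScale_mul_powScale]
      have : powScale s β ^ 3 = powScale (3 * s) β := by
        rw [pow_succ, pow_two, powScale_mul_powScale, powScale_mul_powScale]; ring_nf
      rw [this]; ring_nf
    rw [e]
    have h1 : powScale (3 * s - 1 / 2) β * powScale (1 / 2) β ≤ powScale (3 * s - 1 / 2) β * (powScale (1 / 2) β * btLog β) := by
      have := mul_le_mul_of_nonneg_left hℓ1 (mul_nonneg (powScale_pos (3 * s - 1 / 2) β).le hx0.le)
      nlinarith [this]
    nlinarith [h1]
  -- the polynomial conditions at `rF = ps(1/2)ℓ`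
  have hq' : 2 * C * ((min (1 / 40) (powScale (1 / 2) β * btLog β)) / 100 + Real.sqrt (6 * Fintype.card (Edge 3 L)) * (160 * (3 * L * (2 + 43 * M)) ^ 2 + 10 / 3 * (3 * L * (2 + 43 * M)) + 12 * (3 * L * (2 + 43 * M)) + 152 * (6 * (3 * L * (2 + 43 * M)) + 1 / 12)) * (14 * powScale s β) ^ 2) ≤ 1 / 80 := by rw [hrf]; exact hq
  have hfin' : Real.sqrt (6 * Fintype.card (Edge 3 L)) * (640 * (8 * C ^ 2 * (min (1 / 40) (powScale (1 / 2) β * btLog β)) / 10 ^ 4 + 8 * C ^ 2 * Real.sqrt (6 * Fintype.card (Edge 3 L)) ^ 2 * (160 * (3 * L * (2 + 43 * M)) ^ 2 + 10 / 3 * (3 * L * (2 + 43 * M)) + 12 * (3 * L * (2 + 43 * M)) + 152 * (6 * (3 * L * (2 + 43 * M)) + 1 / 12)) ^ 2 * ((14 * powScale s β) * (14 ^ 3 * powScale (3 * s - 1 / 2) β))) + 20 / 3 * (2 * C * (min (1 / 40) (powScale (1 / 2) β * btLog β)) / 100 + 2 * C * Real.sqrt (6 * Fintype.card (Edge 3 L))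 * (160 * (3 * L * (2 + 43 * M)) ^ 2 + 10 / 3 * (3 * L * (2 + 43 * M)) + 12 * (3 * L * (2 + 43 * M)) + 152 * (6 * (3 * L * (2 + 43 * M)) + 1 / 12)) * (14 * powScale s β) ^ 2) + 1836 * (2 * C * (14 * powScale s β) / 100 + 2 * C * Real.sqrt (6 * Fintype.card (Edge 3 L)) * (160 * (3 * L * (2 + 43 * M)) ^ 2 + 10 / 3 * (3 * L * (2 + 43 * M)) + 12 * (3 * L * (2 + 43 * M)) + 152 * (6 * (3 * L * (2 + 43 * M)) + 1 / 12)) * (14 ^ 3 * powScale (3 * s - 1 / 2) β)) + 38 / 3 * (14 * powScale s β)) ≤ 1 / 10000 := by rw [hrf]; exact hfin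
  obtain ⟨h1, h2, h3⟩ := stiffSep_conditions (L := L) hC hM hrF0 hτ0 hδ0 hδ'0 haU0 hε₁0 hrF hδ hδ' haU hτ hε13 hθ hq' hfin'
  exact ⟨hrF0, by linarith, hτ0, hδ0, hδ1, hδ'0, haU0, hδC, h1, h2, h3⟩

end Summit.QuantumFields.YangMills.Theorems.FemtoTransferGap.TwoLattice.ConstTube

end
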